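import Literature.AnabelianGeometry.SemiGraphs.TemperedDecompositionSubgroupsCommTerminal
import Literature.AnabelianGeometry.SemiGraphs.TemperedDecompositionCommTerminal
import HarnessLib

/-!
# Junction: (P1) «`ι⁻¹(closure ι(Π^tp_ℍ)) = Π^tp_ℍ`» for EVERY decomposition subgroup, modulo `IsInducing φ`
# (abc-iut-w5-d240's `…_of_isClosed` ∘ abc-iut-w4-d052's `isClosed_of_mem_decompSubgroups_of_isInducing`)

Mochizuki, *Inter-universal Teichmüller theory I*, §2, Cor. 2.3 (v) pp. 48–50 [cite: Mochizuki2012, IUTchI Cor 2.3(v) pp.49-50]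
(`[claim: Mochizuki2012, status: disputed]`; nothing of the series is asserted); Mochizuki, *Semi-graphs of
anabelioids* (2006), Def. 3.1 (i) p. 33 [cite: MochizukiSemiAnbd2006, Def 3.1(i) p.33].

PROOF-ONLY junction (abc-iut cell, layer L3, row «DECOMP-PROFINITE», sub-row (P1) of GAP row G-w5d028-2; seat
abc-iut-w5-d240 gen 6; no definition).  abc-iut-L3-lead γ1 (1)/(4) ruled «hDcl := d052 ∘ (B) ∘ (C) by name»:
the closedness hypothesis of `comap_topologicalClosure_map_eq_of_mem_decompSubgroups_of_isClosed`
(`TemperedDecompositionSubgroupsProfinitelyClosed.lean`) is discharged for EVERY `D ∈ c.decompSubgroups ℍ` by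
abc-iut-w4-d052's `TemperedPiChart.isClosed_of_mem_decompSubgroups_of_isInducing` (p468171) from ONE decomposition
homomorphism `φ` inducing the topology (`Topology.IsInducing φ`, to be supplied by d052's (B)
`IsDecompHom.isInducing_of_dom` from abc-iut-L3-d1's (C) domination):

* `comap_topologicalClosure_map_eq_of_mem_decompSubgroups_of_isInducing` — (P1) for every decomposition subgroup,
  modulo `IsInducing φ` (+ the graph hypotheses of the `_of_isClosed` theorem);
* `IsTempered.cofinal_of_isInducing` — the two residual currencies agree: `IsInducing φ` ⟹ the COFINALITY
  `hcof` of `TemperedClosedRangeOfCofinal.lean` / `TemperedDecompositionSubgroupsCommTerminal.lean` (so those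
  files' (P1)/(P2) routes also consume (B)∘(C) by name; abc-iut-w4-d052's `IsTempered.isClosed_range_of_isInducing`
  is the closedness engine OF RECORD, `IsTempered.isClosed_range_of_comap_cofinal` an independent second proof).

Nothing here takes a side on [IUTchIII] Cor. 3.12; typed ≠ proved for the [IUTchI] claim keys.
-/

namespace Literature.AnabelianGeometry.SemiGraphs

open _root_.Topology

universe u v

/-- **`IsInducing` ⟹ cofinality**: if `φ : Γ' → Γ` induces the topology of `Γ'` and the open normal subgroups
of `Γ` form a basis of neighbourhoods of `1` (`IsTempered.basis`), then every open normal subgroup of `Γ'`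
contains `φ⁻¹(N)` for some open normal `N ≤ Γ`. [cite: MochizukiSemiAnbd2006, Def 3.1(i) p.33] -/
theorem IsTempered.cofinal_of_isInducing {Γ' : Type u} [Group Γ'] [TopologicalSpace Γ'] {Γ : Type v}
    [Group Γ] [TopologicalSpace Γ] (hΓ : IsTempered Γ) (φ : Γ' →ₜ* Γ) (hind : Topology.IsInducing φ) :
    ∀ N' : OpenNormalSubgroup Γ', ∃ N : OpenNormalSubgroup Γ, N.toSubgroup.comap φ.toMonoidHom ≤ N'.toSubgroup := by
  intro N'
  obtain ⟨V, hVo, hVN'⟩ := hind.isOpen_iff.1 N'.isOpen'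
  have h1V : V ∈ 𝓝 (1 : Γ) := hVo.mem_nhds (by
    have : (1 : Γ') ∈ (φ : Γ' → Γ) ⁻¹' V := by rw [hVN']; exact N'.toSubgroup.one_mem
    simpa using this)
  obtain ⟨N, -, hNV⟩ := hΓ.basis V h1V
  refine ⟨N, fun x hx => ?_⟩
  have : x ∈ (φ : Γ' → Γ) ⁻¹' V := hNV hx
  rw [hVN'] at this
  exact this

namespace ProfiniteSemiGraph

namespace TemperedPiChart

variable {𝒢 : ProfiniteSemiGraph.{u}}

/-- **[IUTchI] Cor. 2.3 (v) for EVERY decomposition subgroup of `ℍ`, modulo `IsInducing φ`** (the junction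
ruled by abc-iut-L3-lead γ1): `𝒢`, `𝒢_ℍ` finite coherent Prop-3.6 graphs, `𝒢` with a closed edge, ONE
decomposition homomorphism `φ` of `ℍ` inducing the topology of `π₁^temp(𝒢_ℍ)`; then for ANY profinite
completion `ι` of `π₁^temp(𝒢)` and ANY `D ∈ c.decompSubgroups ℍ`: `ι⁻¹(closure ι(D)) = D`.  The [IUTchI]
sentence is a `[claim: Mochizuki2012, status: disputed]` item; PROVED is the displayed statement.
[cite: Mochizuki2012, IUTchI Cor 2.3(v) pp.49-50] -/
theorem comap_topologicalClosure_map_eq_of_mem_decompSubgroups_of_isInducing {H : 𝒢.graph.Subgraph}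
    [Finite 𝒢.graph.Vertex] [Finite 𝒢.graph.Edge] [Finite (𝒢.restrict H).graph.Vertex]
    [Finite (𝒢.restrict H).graph.Edge] (h36 : 𝒢.Prop36Hypotheses) (hcoh : 𝒢.IsCoherent)
    (hcl : ∃ e : 𝒢.graph.Edge, 𝒢.graph.IsClosedEdge e) (h36' : (𝒢.restrict H).Prop36Hypotheses)
    (hcoh' : (𝒢.restrict H).IsCoherent) (c : TemperedPiChart 𝒢) {c' : TemperedPiChart (𝒢.restrict H)}
    {φ : c'.G →ₜ* c.G} (hφ : c.IsDecompHom H c' φ) (hind : Topology.IsInducing φ)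
    {P : Type v} [Group P] [TopologicalSpace P] [IsTopologicalGroup P] {ι : c.G →ₜ* P}
    (hι : IsProfiniteCompletion ι) {D : Subgroup c.G} (hD : D ∈ c.decompSubgroups H) :
    ((D.map ι.toMonoidHom).topologicalClosure).comap ι.toMonoidHom = D :=
  comap_topologicalClosure_map_eq_of_mem_decompSubgroups_of_isClosed h36 hcoh hcl h36' hcoh' c hι hD
    (isClosed_of_mem_decompSubgroups_of_isInducing hφ hind hD).2

/-- The (P2) route of `TemperedDecompositionSubgroupsCommTerminal.lean` in the `IsInducing` currency (second
route to abc-iut-w4-d052's `decompSubgroupsCommensurablyTerminal_of_isInducing`, via [SemiAnbd] Cor. 2.7 (i) on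
the profinite side instead of `CompactInVerticialAt`). [cite: Mochizuki2012, IUTchI Prop 2.2 p.45] -/
theorem decompSubgroupsCommensurablyTerminal_of_isDecompHom_of_isInducing {H : 𝒢.graph.Subgraph}
    [Finite 𝒢.graph.Vertex] [Finite 𝒢.graph.Edge] [Finite (𝒢.restrict H).graph.Vertex]
    [Finite (𝒢.restrict H).graph.Edge] (h36 : 𝒢.Prop36Hypotheses) (hcoh : 𝒢.IsCoherent)
    (hcl : ∃ e : 𝒢.graph.Edge, 𝒢.graph.IsClosedEdge e) (h36' : (𝒢.restrict H).Prop36Hypotheses)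
    (hcoh' : (𝒢.restrict H).IsCoherent)
    (hq : (𝒢.toAnab.restrict 𝒢.toAnab.graph.maximalSubgraph).IsQuasiCoherent)
    (hel : ∀ v : H.toSemiGraph.Vertex,
      (𝒢.toAnab.restrict 𝒢.toAnab.graph.maximalSubgraph).IsElevated ⟨v.1, trivial⟩)
    (c : TemperedPiChart 𝒢) (c' : TemperedPiChart (𝒢.restrict H)) {φ : c'.G →ₜ* c.G}
    (hφ : c.IsDecompHom H c' φ) (hind : Topology.IsInducing φ) : c.DecompSubgroupsCommensurablyTerminal H := by
  haveI := c.isTopologicalGroup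
  exact decompSubgroupsCommensurablyTerminal_of_isDecompHom_of_cofinal h36 hcoh hcl h36' hcoh' hq hel c c' hφ
    (c.isTempered.cofinal_of_isInducing φ hind)

end TemperedPiChart

end ProfiniteSemiGraph

end Literature.AnabelianGeometry.SemiGraphs
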